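import Literature.NumberTheory.Automorphic.QuaternionUnitsTraceNormalized
import HarnessLib

/-!
# The terms of the `D^×` trace formula, one class at a time, with the printed constant
(Gelbart, *Automorphic forms on adele groups* (1975), (10.14) and Remark 9.23:
`meas(Z'_𝔸 G'(γ)_F \ G'(γ)_𝔸) ∫_{G'(γ)_𝔸 \ G'_𝔸} Φ'(x⁻¹ γ x) dx`)

Topic `NumberTheory/Automorphic`; theorems only (no definition, no named fact, no instance). The
one-class form of the geometric side of `QuaternionUnitsTraceNormalized`
(`units_lintegral_conjTsum_eq_mul_tsum_covol_mul` sums all classes at once), parallel to the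
`GL(2)` statement `glTwo_lintegral_conjTsum_conjOrbit_eq_covol_mul` (`GLTwoEllipticClassTerm`),
so that the terms of (10.14) and (10.15) can be compared class by class
(`QuaternionGLTwoClasses*`, `QuaternionGLTwoTorusComparison`).

For a division quaternion algebra `D` over the number field `K`, `𝒢 = AdelicGroupData.units K D`
(`G = D_𝔸ˣ`, `Γ = Dˣ`, `L = ℝ_{>0} Dˣ`, `X = G ⧸ L` compact), `γ ∈ Dˣ` (any class: central or
regular), `G_γ = C_G(γ)`, `H_γ = L ∩ G_γ`:

* `units_lintegral_conjTsum_conjOrbit_eq_covol_mul` — **the term of the class of `γ` with the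
  printed constant**: for an automorphic measure `μ`, a two-sided Haar measure `ν` on `G`, Haar
  measures `ρ_L` on `L`, `ν_γ` on `G_γ`, `ρ_H = ρ_L|_{H_γ}`, `ρ_F` its transport to `H_γ ≤ G_γ`, and
  Borel `F : G → [0, ∞]`,
  `∫_X Σ'_{s ∈ [γ]} F(x̃ s x̃⁻¹) dμ = c_μ · vol(G_γ ⧸ H_γ) · ∫_{G ⧸ G_γ} F(y γ y⁻¹) d(ν/ν_γ)` with
  `c_μ = unfoldingConstant L ρ_L μ ν` — the summand `meas(Z'_𝔸 G'(γ)_F \ G'(γ)_𝔸) ∫ Φ'(x⁻¹ γ x) dx`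
  of (10.14) (instantiation of
  `Literature.MeasureTheory.Group.lintegral_conjTsum_conjOrbit_eq_covol_mul` with the per-class
  inputs of `QuaternionUnitsTraceClasses`: `units_compactSpace_centralizer_quotient`, the central
  retraction and the discreteness of `Dˣ`);
* `units_exists_restricted_haar_one` — non-vacuity of `ρ_H`, `ρ_F` for `ρ_L = (α ⊗ counting)`;
* `units_classTerm_hypotheses` — the instance binders hold (`units_adelic_topology`,
  `isClosed_quotientSubgroup_units`, `isClosed_centralizer_singleton`).

A brick of the inline (D-0026) decomposition of
`Literature.NumberTheory.Automorphic.strong_multiplicity_one_quaternionUnits` (Gelbart Thm. 10.5).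

## References

* S. Gelbart, *Automorphic forms on adele groups*, Ann. of Math. Studies 83 (1975), Remark 9.23
  and (10.14) [Gelbart1975].
-/

noncomputable section

open scoped NNReal ENNReal
open NumberField IsDedekindDomain MeasureTheory Measure Topology
open Literature.MeasureTheory.Group

namespace Literature.NumberTheory.Automorphic

-- the coset spaces carry Borel σ-algebras supplied locally, not the quotient σ-algebra
attribute [-instance] Quotient.instMeasurableSpace QuotientGroup.measurableSpace

universe u

section OneClass

variable (K : Type) [Field K] [NumberField K] (D : Type u) [Ring D] [Algebra K D] [IsQuaternionAlgebra K D]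
  (γ : Dˣ)

/-- The adelic group datum of `D^×`. -/
local notation "GD" => AdelicGroupData.units K D

/-- `G_γ = C_{D_𝔸ˣ}(γ)` (spelled `AdelicGroupData.toAdelic GD γ`, i.e. `(GD).toAdelic γ`). -/
local notation "Cq" => Subgroup.centralizer ({AdelicGroupData.toAdelic (AdelicGroupData.units K D) γ} :
  Set (AdelicGroupData.Adelic (AdelicGroupData.units K D)))

attribute [local instance] AdelicGroupData.measurableSpaceQuotientForm
  AdelicGroupData.borelSpaceQuotientForm AdelicGroupData.smulInvariantMeasureQuotientForm
  AdelicGroupData.isFiniteMeasureOnCompactsQuotientForm AdelicGroupData.isFiniteMeasureQuotientForm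

/-- **The term of one class of the `D^×` trace formula, with the printed constant** (Gelbart
(1975), (10.14): `meas(Z'_𝔸 G'(γ)_F \ G'(γ)_𝔸) ∫_{G'(γ)_𝔸 \ G'_𝔸} Φ'(x⁻¹ γ x) dx`; Remark 9.23 for the
unfolding). Let `D` be a division quaternion algebra over the number field `K`,
`𝒢 = AdelicGroupData.units K D` (`G = D_𝔸ˣ`, `Γ = Dˣ`, `L = ℝ_{>0} Dˣ`), `γ ∈ Dˣ`, `G_γ = C_G(γ)`
(closed; `K(γ)_𝔸ˣ` or all of `G`), `H_γ = L ∩ G_γ`; `μ` an automorphic measure on `X = G ⧸ L`, `ν` a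
two-sided Haar measure on `G`, `ρ_L` a Haar measure on `L`, `ν_γ` a Haar measure on `G_γ` (two-sided
and inversion invariant: `units_isMulRightInvariant_centralizer`, `units_isInvInvariant_centralizer`),
`ρ_H = ρ_L|_{H_γ}` and `ρ_F` its transport to `H_γ ≤ G_γ`. Then for Borel `F : G → [0, ∞]`:

  `∫_X Σ'_{s ∈ [γ]} F(x̃ s x̃⁻¹) dμ(x) = c_μ · vol(G_γ ⧸ H_γ) · ∫_{G ⧸ G_γ} F(y γ y⁻¹) d(ν/ν_γ)(y)`,

`[γ]` the `Dˣ`-conjugacy class of `γ`, `c_μ = unfoldingConstant L ρ_L μ ν`,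
`ν/ν_γ = quotientMeasure G_γ ν_γ ν` and `vol(G_γ ⧸ H_γ)` the total mass of
`quotientMeasure (H_γ ⊓ G_γ) ρ_F ν_γ` — `meas(Z'_𝔸 G'(γ)_F \ G'(γ)_𝔸)` (finite:
`units_compactSpace_centralizer_quotient`). The instance binders hold by
`units_classTerm_hypotheses`. [cite: Gelbart1975, (10.14) and Remark 9.23] -/
theorem units_lintegral_conjTsum_conjOrbit_eq_covol_mul (hdiv : ∀ x : D, x ≠ 0 → IsUnit x)
    [MeasurableSpace (GD).Adelic] [BorelSpace (GD).Adelic]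
    [LocallyCompactSpace (GD).Adelic] [SecondCountableTopology (GD).Adelic] [T2Space (GD).Adelic]
    [hH : IsClosed ((GD).quotientSubgroup : Set (GD).Adelic)]
    [hCcl : IsClosed ((Cq : Subgroup (GD).Adelic) : Set (GD).Adelic)]
    [MeasurableSpace ((GD).Adelic ⧸ Cq)] [BorelSpace ((GD).Adelic ⧸ Cq)]
    [MeasurableSpace (↥Cq ⧸ ((GD).quotientSubgroup ⊓ Cq).subgroupOf Cq)]
    [BorelSpace (↥Cq ⧸ ((GD).quotientSubgroup ⊓ Cq).subgroupOf Cq)]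
    (μ : Measure (GD).automorphicQuotient) [(GD).IsAutomorphicMeasure μ]
    (ν : Measure (GD).Adelic) [IsHaarMeasure ν] [ν.IsMulRightInvariant]
    (ρL : Measure (GD).quotientSubgroup) [ρL.IsHaarMeasure] [SFinite ρL]
    (ρH : Measure ↥((GD).quotientSubgroup ⊓ Cq)) [IsHaarMeasure ρH] [ρH.IsInvInvariant] [SFinite ρH]
    (ρF : Measure ↥(((GD).quotientSubgroup ⊓ Cq).subgroupOf Cq))
    [IsHaarMeasure ρF] [ρF.IsInvInvariant] [SFinite ρF]
    (νC : Measure Cq) [IsHaarMeasure νC] [νC.IsMulRightInvariant] [νC.IsInvInvariant] [SFinite νC]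
    (hρH : ρH = ρL.comap (Subgroup.inclusion inf_le_left))
    (hρF : ρF = Measure.map (Subgroup.subgroupOfEquivOfLe inf_le_right).symm ρH)
    {F : (GD).Adelic → ℝ≥0∞} (hF : Measurable F) :
    ∫⁻ x, conjTsum (GD).quotientSubgroup (conjOrbit (GD).arithmeticSubgroup ((GD).toAdelic γ))
        (conj_mem_conjOrbit_of_exists (GD).arithmeticSubgroup (GD).quotientSubgroup
          (AdelicGroupData.exists_inv_mul_mem_centralizer_quotientSubgroup (GD)) ⟨γ, rfl⟩) F x ∂μ =
      unfoldingConstant (GD).quotientSubgroup ρL μ ν *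
        quotientMeasure (((GD).quotientSubgroup ⊓ Cq).subgroupOf Cq) ρF
            (isClosed_subgroupOf _ _ (hH.inter hCcl)) νC Set.univ *
          ∫⁻ y, descConj ((GD).toAdelic γ) Cq (mem_centralizer_singleton_comm _) F y
            ∂quotientMeasure Cq νC hCcl ν := by
  have h4 : Module.finrank K D = 4 := IsQuaternionAlgebra.finrank_eq_four (K := K) (D := D)
  haveI : Nontrivial D := Module.nontrivial_of_finrank_pos (R := K) (by omega)
  haveI : Countable (GD).arithmeticSubgroup := AdelicGroupData.countable_arithmeticSubgroup_units K D
  have hdisc : (GD).IsDiscreteRational := AdelicGroupData.units_isDiscreteRational_holds K D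
  haveI : LocallyCompactSpace (AdeleRing (𝓞 K) K) := locallyCompactSpace_adeleRing' K
  obtain ⟨θ, hθc, hθA, hθa, hθγ⟩ := exists_centralRetraction_units K D
  haveI : IsClosed ((((GD).quotientSubgroup ⊓ Cq) : Subgroup (GD).Adelic) : Set (GD).Adelic) :=
    hH.inter hCcl
  haveI : CompactSpace (↥Cq ⧸ ((GD).quotientSubgroup ⊓ Cq).subgroupOf Cq) :=
    units_compactSpace_centralizer_quotient K D hdiv ⟨γ, rfl⟩
  have hopen : IsOpen (((((GD).quotientSubgroup ⊓ Cq).subgroupOf (GD).quotientSubgroup :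
      Subgroup (GD).quotientSubgroup)) : Set (GD).quotientSubgroup) :=
    AdelicGroupData.isOpen_subgroupOf_quotientSubgroup_of_center'_le (GD) hdisc θ hθc hθA hθa hθγ
      (AdelicGroupData.center'_le_inf_centralizer (GD) _)
  exact Literature.MeasureTheory.Group.lintegral_conjTsum_conjOrbit_eq_covol_mul
    (Γ := (GD).arithmeticSubgroup) (L := (GD).quotientSubgroup)
    (hΓL := (GD).arithmeticSubgroup_le_quotientSubgroup)
    (hLΓ := AdelicGroupData.exists_inv_mul_mem_centralizer_quotientSubgroup (GD))
    (hγ₀ := ⟨γ, rfl⟩) (H₀ := (GD).quotientSubgroup ⊓ Cq) (G₀ := Cq)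
    (hH₀ := fun g => mem_inf_centralizer_singleton_iff _ _ _) (hHG := inf_le_right)
    (hG₀ := mem_centralizer_singleton_comm _) (μ := μ) (ν := ν) (ρL := ρL) (ρH := ρH) (ρF := ρF)
    (ν₀ := νC) (hopen := hopen) (hμ := AdelicGroupData.IsAutomorphicMeasure.ne_zero (GD) μ)
    (hρH := hρH) (hρF := hρF) (hF := hF)

/-- **The restricted Haar measures exist** (non-vacuity of the parameters `ρ_H`, `ρ_F` for one
class): for a Haar measure `α` on `A_G = ℝ_{>0}`, the restriction `ρ_H` of the Haar measure
`ρ_L = ((a, δ) ↦ a δ)_* (α ⊗ counting)` of `L = ℝ_{>0} Dˣ` to `H_γ = L ∩ G_γ` (relatively open in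
`L`) is a Haar measure of `H_γ`, inversion invariant and s-finite, and so is its transport `ρ_F` to
`H_γ ≤ G_γ` (cf. `units_exists_restricted_haar`, all classes at once). [folklore] -/
theorem units_exists_restricted_haar_one
    [MeasurableSpace (GD).Adelic] [BorelSpace (GD).Adelic]
    [LocallyCompactSpace (GD).Adelic] [SecondCountableTopology (GD).Adelic] [T2Space (GD).Adelic]
    [hH : IsClosed ((GD).quotientSubgroup : Set (GD).Adelic)]
    [hCcl : IsClosed ((Cq : Subgroup (GD).Adelic) : Set (GD).Adelic)]
    (α : Measure (GD).center') [α.IsHaarMeasure] [SFinite α] :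
    ∃ (ρH : Measure ↥((GD).quotientSubgroup ⊓ Cq))
      (ρF : Measure ↥(((GD).quotientSubgroup ⊓ Cq).subgroupOf Cq)),
      IsHaarMeasure ρH ∧ ρH.IsInvInvariant ∧ SFinite ρH ∧
      IsHaarMeasure ρF ∧ ρF.IsInvInvariant ∧ SFinite ρF ∧
      ρH = (Measure.map (fun p : (GD).center' × (GD).arithmeticSubgroup =>
        (⟨(p.1 : (GD).Adelic) * p.2, AdelicGroupData.mulMap_mem (GD) p⟩ : (GD).quotientSubgroup))
          (α.prod count)).comap (Subgroup.inclusion inf_le_left) ∧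
      ρF = Measure.map (Subgroup.subgroupOfEquivOfLe inf_le_right).symm ρH := by
  have h4 : Module.finrank K D = 4 := IsQuaternionAlgebra.finrank_eq_four (K := K) (D := D)
  haveI : Nontrivial D := Module.nontrivial_of_finrank_pos (R := K) (by omega)
  haveI : Countable (GD).arithmeticSubgroup := AdelicGroupData.countable_arithmeticSubgroup_units K D
  have hdisc : (GD).IsDiscreteRational := AdelicGroupData.units_isDiscreteRational_holds K D
  haveI : LocallyCompactSpace (AdeleRing (𝓞 K) K) := locallyCompactSpace_adeleRing' K
  obtain ⟨θ, hθc, hθA, hθa, hθγ⟩ := exists_centralRetraction_units K D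
  set ρ₀ : Measure (GD).quotientSubgroup := Measure.map
    (fun p : (GD).center' × (GD).arithmeticSubgroup =>
      (⟨(p.1 : (GD).Adelic) * p.2, AdelicGroupData.mulMap_mem (GD) p⟩ : (GD).quotientSubgroup))
    (α.prod count) with hρ₀
  haveI : ρ₀.IsHaarMeasure :=
    AdelicGroupData.isHaarMeasure_map_mul_prod_count (GD) hdisc θ hθc hθA hθa hθγ α
  haveI : ρ₀.IsMulRightInvariant := AdelicGroupData.isMulRightInvariant_quotientSubgroup_units K D ρ₀
  haveI : ρ₀.IsInvInvariant := isInvInvariant_of_isMulRightInvariant ρ₀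
  haveI hHcl : IsClosed ((((GD).quotientSubgroup ⊓ Cq) : Subgroup (GD).Adelic) : Set (GD).Adelic) :=
    hH.inter hCcl
  have hopen : IsOpen (((((GD).quotientSubgroup ⊓ Cq).subgroupOf (GD).quotientSubgroup :
      Subgroup (GD).quotientSubgroup)) : Set (GD).quotientSubgroup) :=
    AdelicGroupData.isOpen_subgroupOf_quotientSubgroup_of_center'_le (GD) hdisc θ hθc hθA hθa hθγ
      (AdelicGroupData.center'_le_inf_centralizer (GD) _)
  set ρH : Measure ↥((GD).quotientSubgroup ⊓ Cq) := ρ₀.comap (Subgroup.inclusion inf_le_left) with hρH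
  haveI hHa : IsHaarMeasure ρH := isHaarMeasure_comap_subgroupInclusion _ _ inf_le_left hopen ρ₀
  haveI hHi : ρH.IsInvInvariant :=
    isInvInvariant_comap (Subgroup.inclusion inf_le_left)
      (measurableEmbedding_subgroupInclusion _ _ inf_le_left hHcl) ρ₀
  set ρF : Measure ↥(((GD).quotientSubgroup ⊓ Cq).subgroupOf Cq) :=
    Measure.map (Subgroup.subgroupOfEquivOfLe (inf_le_right : (GD).quotientSubgroup ⊓ Cq ≤ _)).symm ρH
    with hρF
  have hFa : IsHaarMeasure ρF :=
    MulEquiv.isHaarMeasure_map ρH _ (continuous_subgroupOfEquivOfLe_symm _ _ inf_le_right)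
      (continuous_subgroupOfEquivOfLe _ _ inf_le_right)
  have hFi : ρF.IsInvInvariant :=
    isInvInvariant_map_mulEquiv _ (continuous_subgroupOfEquivOfLe_symm _ _ inf_le_right).measurable ρH
  exact ⟨ρH, ρF, hHa, hHi, inferInstance, hFa, hFi, inferInstance, rfl, rfl⟩

/-- **The hypotheses of `units_lintegral_conjTsum_conjOrbit_eq_covol_mul` hold**: `D_𝔸ˣ` is locally
compact, second countable and Hausdorff; `ℝ_{>0} Dˣ` and `G_γ` are closed. [folklore] -/
theorem units_classTerm_hypotheses :
    LocallyCompactSpace (GD).Adelic ∧ SecondCountableTopology (GD).Adelic ∧ T2Space (GD).Adelic ∧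
      IsClosed ((GD).quotientSubgroup : Set (GD).Adelic) ∧
      IsClosed ((Cq : Subgroup (GD).Adelic) : Set (GD).Adelic) := by
  have h4 : Module.finrank K D = 4 := IsQuaternionAlgebra.finrank_eq_four (K := K) (D := D)
  haveI : Nontrivial D := Module.nontrivial_of_finrank_pos (R := K) (by omega)
  obtain ⟨i₁, i₂, i₃⟩ := units_adelic_topology K D
  haveI : T2Space (GD).Adelic := i₂
  exact ⟨i₁, i₃, i₂, AdelicGroupData.isClosed_quotientSubgroup_units K D, isClosed_centralizer_singleton _⟩

end OneClass

end Literature.NumberTheory.Automorphic
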